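import Literature.Computability.AlgebraicComplexity.GraphTensorFlattening
import HarnessLib

/-!
# Cliques: the edges of `K_k` crossing a vertex cut, the max-cut flattening bound `⌊k²/4⌋ ≤ ω(T(K_k))`
# (Christandl–Vrana–Zuiddam 2019, §1.2 eq. (1.4)) and `τ(K_k) ≥ 1/2` (Brand et al. 2026, Remark 21)

Topic `Literature/Computability/AlgebraicComplexity`, sequel of `GraphTensor.lean` (`cliqueSlots`, `graphOmega`,
`graphTau`, `card_cliqueEdge`) and `GraphTensorFlattening.lean` (`crosses`, `card_crossing_le_graphOmega`).
Everything here is PROVED (no named fact).  Definition item `defn-GraphTensor` (route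
`route-MatrixMultiplication-TetrahedronCarving`).

## What is printed

[CVZ19] Christandl–Vrana–Zuiddam, arXiv:1609.07476, §1.2 (p. 9): "For the complete graph `K_k`, the maximum cut
size `f(K_k)` is `k²/4` for even `k` and `(k−1)(k+1)/4` for odd `k` … Then, flattening `T(K_k)` along a max-cut
yields a matrix of rank `2^{f(K_k)}` and therefore (1.4) `τ(T(K_k)) ≥ f(K_k)/binom(k,2) = 1/2 + 1/(2k)` for odd
`k`, `1/2 + 1/(2(k−1))` for even `k`."  [BCKLOSW26] Brand et al., arXiv:2602.11975, Remark 21 (p. 17): "the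
`k`-matching tensor … rank … equals a matrix-flattening-rank lower bound … implying `τ(d) ≥ 1/2` … for all
`d ≥ 4`."

## What is typed (all PROVED)

* `crosses_cliqueSlots_iff`: an edge of `K_{d+1}` crosses the cut `c` iff its endpoints lie on different sides;
  `crossingEdge` / `crossingEdge_bijective`; **`card_crossing_cliqueSlots : #{crossing} = #S · #(V∖S)`**;
  `card_mul_card_le_graphOmega_cliqueSlots : #S · #(V∖S) ≤ ω(T(K_{d+1}))` (every field).
* `segmentCut d a = {v | v < a}`, `mul_sub_le_graphOmega_cliqueSlots : a(k − a) ≤ ω(T(K_k))`,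
  `half_mul_sub_half : ⌊k/2⌋(k − ⌊k/2⌋) = ⌊k²/4⌋`, **`sq_div_four_le_graphOmega_cliqueSlots : ⌊k²/4⌋ ≤
  ω(T(K_k))`** (eq. (1.4), `k = d + 1`), `choose_two_le_two_mul_sq_div_four : binom(k,2) ≤ 2⌊k²/4⌋`,
  **`half_le_graphTau_cliqueSlots : 1/2 ≤ τ(T(K_k))`** for `k ≥ 2` (Remark 21's lower bound, here from the
  max-cut rather than the matching flattening — the same constant).

No `sorry`, no axiom, no instance, no notation, no `Prop`-valued definition.

## References

* [CVZ19] Christandl–Vrana–Zuiddam, arXiv:1609.07476, Ex. 1.1.2, Ex. 1.1.21, §1.2 (eq. (1.4)).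
  [ChristandlVranaZuiddam2016]
* [BCKLOSW26] Brand–Curticapean–Kaski–Li–Orzel–Seppelt–Wang, arXiv:2602.11975, Remark 21 (p. 17). [BrandEtAl2026]
-/

noncomputable section

open scoped BigOperators

namespace Literature.Computability.AlgebraicComplexity

section CliqueCut

variable (F : Type*) [Field F]

/-- A vertex reading an edge of `K_{d+1}` is an endpoint of it. [cite: ChristandlVranaZuiddam2016, Ex. 1.1.2] -/
theorem mem_of_cliqueSlots_eq {d : ℕ} {v : Fin (d + 1)} {j : Fin d} {e : CliqueEdge (d + 1)}
    (h : cliqueSlots d v j = e) : v ∈ e.1 := by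
  rw [← h]
  exact Sym2.mem_mk_left _ _

/-- Each endpoint of an edge of `K_{d+1}` reads it in some slot. [cite: ChristandlVranaZuiddam2016, Ex. 1.1.2] -/
theorem exists_cliqueSlots_eq_of_mem {d : ℕ} {v : Fin (d + 1)} {e : CliqueEdge (d + 1)} (h : v ∈ e.1) :
    ∃ j, cliqueSlots d v j = e := by
  obtain ⟨e, he⟩ := e
  induction e using Sym2.ind with
  | h a b =>
    have hab : a ≠ b := fun hab => he (by rw [Sym2.mk_isDiag_iff]; exact hab)
    rcases Sym2.mem_iff.1 h with rfl | rfl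
    · obtain ⟨j, hj⟩ := Fin.exists_succAbove_eq hab.symm
      exact ⟨j, Subtype.ext (by simp [cliqueSlots, hj])⟩
    · obtain ⟨j, hj⟩ := Fin.exists_succAbove_eq hab
      exact ⟨j, Subtype.ext (by simp [cliqueSlots, hj, Sym2.eq_swap])⟩

/-- **An edge of `K_{d+1}` crosses a vertex cut iff its endpoints lie on different sides.**
[cite: ChristandlVranaZuiddam2016, Ex. 1.1.21] -/
theorem crosses_cliqueSlots_iff {d : ℕ} (c : Fin (d + 1) → Bool) (e : CliqueEdge (d + 1)) :
    crosses (cliqueSlots d) c e = true ↔ ∃ a b, c a = true ∧ c b = false ∧ e.1 = s(a, b) := by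
  rw [crosses_iff]
  constructor
  · rintro ⟨⟨v, j, hv, hvj⟩, ⟨w, j', hw, hwj⟩⟩
    refine ⟨v, w, hv, hw, ?_⟩
    have hw' : w ∈ e.1 := mem_of_cliqueSlots_eq hwj
    have hvw : v ≠ w := fun h => by rw [h, hw] at hv; exact Bool.false_ne_true hv
    rw [← hvj] at hw' ⊢
    simp only [cliqueSlots] at hw' ⊢
    rcases Sym2.mem_iff.1 hw' with h | h
    · exact absurd h.symm hvw
    · rw [h]
  · rintro ⟨a, b, ha, hb, hab⟩
    have hae : a ∈ e.1 := by rw [hab]; exact Sym2.mem_mk_left _ _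
    have hbe : b ∈ e.1 := by rw [hab]; exact Sym2.mem_mk_right _ _
    obtain ⟨j, hj⟩ := exists_cliqueSlots_eq_of_mem hae
    obtain ⟨j', hj'⟩ := exists_cliqueSlots_eq_of_mem hbe
    exact ⟨⟨a, j, ha, hj⟩, ⟨b, j', hb, hj'⟩⟩

/-- The crossing edge `{a, b}` of a pair (`a` on the `true` side, `b` on the `false` side).
[cite: ChristandlVranaZuiddam2016, Ex. 1.1.21] -/
def crossingEdge {d : ℕ} (c : Fin (d + 1) → Bool)
    (p : {a : Fin (d + 1) // c a = true} × {b : Fin (d + 1) // c b = false}) :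
    {e : CliqueEdge (d + 1) // crosses (cliqueSlots d) c e = true} :=
  ⟨⟨s(p.1.1, p.2.1), by
      rw [Sym2.mk_isDiag_iff]
      intro h
      have h1 := p.1.2
      rw [h, p.2.2] at h1
      exact Bool.false_ne_true h1⟩,
    (crosses_cliqueSlots_iff c _).2 ⟨p.1.1, p.2.1, p.1.2, p.2.2, rfl⟩⟩

/-- `crossingEdge` is a bijection: the crossing edges of a cut of `K_{d+1}` are the pairs (one vertex on each
side). [cite: ChristandlVranaZuiddam2016, Ex. 1.1.21] -/
theorem crossingEdge_bijective {d : ℕ} (c : Fin (d + 1) → Bool) : Function.Bijective (crossingEdge c) := by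
  constructor
  · rintro ⟨⟨a, ha⟩, ⟨b, hb⟩⟩ ⟨⟨a', ha'⟩, ⟨b', hb'⟩⟩ h
    have h' : s(a, b) = s(a', b') := congrArg (fun x => x.1.1) h
    rcases Sym2.eq_iff.1 h' with ⟨rfl, rfl⟩ | ⟨rfl, rfl⟩
    · rfl
    · rw [hb'] at ha; exact absurd ha Bool.false_ne_true
  · rintro ⟨e, he⟩
    obtain ⟨a, b, ha, hb, hab⟩ := (crosses_cliqueSlots_iff c e).1 he
    exact ⟨(⟨a, ha⟩, ⟨b, hb⟩), Subtype.ext (Subtype.ext hab.symm)⟩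

/-- **The number of edges of `K_{d+1}` crossing a vertex cut is `#S · #(V ∖ S)`.**
[cite: ChristandlVranaZuiddam2016, §1.2 (eq. (1.4))] -/
theorem card_crossing_cliqueSlots {d : ℕ} (c : Fin (d + 1) → Bool) :
    Fintype.card {e : CliqueEdge (d + 1) // crosses (cliqueSlots d) c e = true} =
      Fintype.card {a : Fin (d + 1) // c a = true} * Fintype.card {b : Fin (d + 1) // c b = false} := by
  rw [← Fintype.card_prod]
  exact (Fintype.card_congr (Equiv.ofBijective _ (crossingEdge_bijective c))).symm

/-- **`#S · #(V ∖ S) ≤ ω(T(K_{d+1}))` for every vertex cut** (flattening, CVZ19 §1.2 eq. (1.4) before maximising).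
[cite: ChristandlVranaZuiddam2016, §1.2 (eq. (1.4))] -/
theorem card_mul_card_le_graphOmega_cliqueSlots {d : ℕ} (c : Fin (d + 1) → Bool) :
    ((Fintype.card {a : Fin (d + 1) // c a = true} * Fintype.card {b : Fin (d + 1) // c b = false} : ℕ) : ℝ) ≤
      graphOmega F (cliqueSlots d) := by
  rw [← card_crossing_cliqueSlots c]
  exact card_crossing_le_graphOmega (cliqueSlots_covering d) c

/-- The initial-segment cut `{v | v < a}` of `K_{d+1}`. [cite: ChristandlVranaZuiddam2016, §1.2 (eq. (1.4))] -/
def segmentCut (d a : ℕ) : Fin (d + 1) → Bool :=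
  fun v => decide (v.val < a)

/-- The initial segment has `a` vertices (`a ≤ d + 1`). [cite: ChristandlVranaZuiddam2016, §1.2 (eq. (1.4))] -/
theorem card_segmentCut_true {d a : ℕ} (ha : a ≤ d + 1) :
    Fintype.card {v : Fin (d + 1) // segmentCut d a v = true} = a := by
  rw [Fintype.card_subtype]
  simp only [segmentCut, decide_eq_true_eq]
  rw [Fin.card_filter_val_lt, min_eq_right ha]

/-- Its complement has `d + 1 − a` vertices. [cite: ChristandlVranaZuiddam2016, §1.2 (eq. (1.4))] -/
theorem card_segmentCut_false {d a : ℕ} (ha : a ≤ d + 1) :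
    Fintype.card {v : Fin (d + 1) // segmentCut d a v = false} = d + 1 - a := by
  have h := Fintype.card_subtype_compl (fun v : Fin (d + 1) => segmentCut d a v = true)
  simp only [Fintype.card_fin, card_segmentCut_true ha] at h
  rw [← h]
  apply Fintype.card_congr
  exact Equiv.subtypeEquivRight fun v => by simp

/-- **`a · (k − a) ≤ ω(T(K_k))`** for every `a ≤ k = d + 1`. [cite: ChristandlVranaZuiddam2016, §1.2 (eq. (1.4))] -/
theorem mul_sub_le_graphOmega_cliqueSlots (d : ℕ) {a : ℕ} (ha : a ≤ d + 1) :
    ((a * (d + 1 - a) : ℕ) : ℝ) ≤ graphOmega F (cliqueSlots d) := by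
  have h := card_mul_card_le_graphOmega_cliqueSlots F (segmentCut d a)
  rwa [card_segmentCut_true ha, card_segmentCut_false ha] at h

/-- The max-cut size of `K_k`: `⌊k/2⌋ · ⌈k/2⌉ = ⌊k²/4⌋` (`k²/4` for even `k`, `(k−1)(k+1)/4` for odd `k`).
[cite: ChristandlVranaZuiddam2016, §1.2 (eq. (1.4))] -/
theorem half_mul_sub_half (k : ℕ) : (k / 2) * (k - k / 2) = k ^ 2 / 4 := by
  obtain ⟨m, rfl | rfl⟩ := Nat.even_or_odd' k
  · have h1 : 2 * m / 2 = m := by omega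
    rw [h1, show 2 * m - m = m by omega, show (2 * m) ^ 2 = 4 * (m * m) by ring]
    omega
  · have h1 : (2 * m + 1) / 2 = m := by omega
    rw [h1, show 2 * m + 1 - m = m + 1 by omega, show (2 * m + 1) ^ 2 = 4 * (m * (m + 1)) + 1 by ring]
    omega

/-- **CVZ19 §1.2 eq. (1.4) (max-cut flattening): `⌊k²/4⌋ ≤ ω(T(K_k))`**, `k = d + 1` — "flattening `T(K_k)` along
a max-cut yields a matrix of rank `2^{f(K_k)}`", `f(K_k) = k²/4` (`k` even), `(k−1)(k+1)/4` (`k` odd).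
[cite: ChristandlVranaZuiddam2016, §1.2 (eq. (1.4))] -/
theorem sq_div_four_le_graphOmega_cliqueSlots (d : ℕ) :
    (((d + 1) ^ 2 / 4 : ℕ) : ℝ) ≤ graphOmega F (cliqueSlots d) := by
  rw [← half_mul_sub_half]
  exact mul_sub_le_graphOmega_cliqueSlots F d (Nat.div_le_self _ _)

/-- `binom(k, 2) ≤ 2 ⌊k²/4⌋`. [cite: BrandEtAl2026, Remark 21] -/
theorem choose_two_le_two_mul_sq_div_four (k : ℕ) : k.choose 2 ≤ 2 * (k ^ 2 / 4) := by
  rw [Nat.choose_two_right]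
  obtain ⟨m, rfl | rfl⟩ := Nat.even_or_odd' k
  · rw [show (2 * m) ^ 2 = 4 * (m * m) by ring, show 2 * m * (2 * m - 1) = 2 * (m * (2 * m - 1)) by ring]
    have : m * (2 * m - 1) ≤ 2 * (m * m) := by
      rcases m with _ | m
      · simp
      · rw [show 2 * (m + 1) - 1 = 2 * m + 1 by omega]; nlinarith
    omega
  · rw [show (2 * m + 1) ^ 2 = 4 * (m * (m + 1)) + 1 by ring, show 2 * m + 1 - 1 = 2 * m by omega,
      show (2 * m + 1) * (2 * m) = 2 * (m * (2 * m + 1)) by ring]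
    have : m * (2 * m + 1) ≤ 2 * (m * (m + 1)) := by nlinarith
    omega

/-- **BCKLOSW26 Remark 21: `τ(d) ≥ 1/2`** — here for every `K_k`, `k = d + 1 ≥ 2`, over every field: `τ(T(K_k)) =
ω(T(K_k))/binom(k,2) ≥ ⌊k²/4⌋/binom(k,2) ≥ 1/2` (print derives it from the `k`-matching flattening; the max-cut
flattening gives the same constant). [cite: BrandEtAl2026, Remark 21] -/
theorem half_le_graphTau_cliqueSlots {d : ℕ} (hd : 1 ≤ d) : (1 / 2 : ℝ) ≤ graphTau F (cliqueSlots d) := by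
  unfold graphTau
  rw [card_cliqueEdge]
  have hpos : (0 : ℝ) < ((d + 1).choose 2 : ℕ) := by
    have : 0 < (d + 1).choose 2 := Nat.choose_pos (by omega)
    exact_mod_cast this
  rw [le_div_iff₀ hpos]
  have h1 := sq_div_four_le_graphOmega_cliqueSlots F d
  have h2 : (((d + 1).choose 2 : ℕ) : ℝ) ≤ 2 * (((d + 1) ^ 2 / 4 : ℕ) : ℝ) := by
    exact_mod_cast choose_two_le_two_mul_sq_div_four (d + 1)
  linarith

end CliqueCut

end Literature.Computability.AlgebraicComplexity

end
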